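import Summits.BirchSwinnertonDyer.Rank1Residual.X12.O11.RouteUJacobiCertificate
import HarnessLib

/-!
# ROUTE U — Euler's criterion for `J(a | p)` in natural-number arithmetic (fast kernel certificates)

bsd-cm cell (run/shared/lean/pub/bsd-cm/), ROUTE U (Theorem U: BSD(49a1^{(D)}, 7)), seat `bsd-cm-ram`
(g6). The Bernoulli-unit certificates of the member files evaluate sums `Σ_j c(j)·jᵉ` with
`decide +kernel`, where `c(j)` is a product of prime Jacobi symbols `J(j | q)`.
`RouteUJacobiCertificate.jacobiSym_prime_eq_ite` rewrites `J(j | q)` by Euler's criterion in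
`ZMod q`, whose powers the kernel evaluates by generic (unary-recursive) monoid exponentiation; this
file gives the same criterion with ALL arithmetic in `ℕ` (`%` and `^`), which the kernel evaluates
with its native big-number arithmetic — an order of magnitude faster per term (measured: a
`10 000`-term block at `q = 271` in seconds), so that the long certificates of the even members
(`7·88·271 = 166 936` terms for `D = −88`) fit in one file. THEOREMS ONLY; nothing booked.
References: [Cox2013] §1.C Lemma 1.14; [Washington1997] §5.1.
-/

open scoped NumberTheorySymbols

namespace Summit.BirchSwinnertonDyer.Rank1Residual.X12.O11.RouteU

/-- **Euler's criterion for the Jacobi symbol at an odd prime, natural-number form**: for `p` an odd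
prime and `a : ℕ`, `J(a | p) = 0` if `a % p = 0`, else `1` or `−1` according as
`(a % p)^{(p−1)/2} % p = 1` or not — all arithmetic in `ℕ`, so that instances at numerals are
evaluated by the kernel's native arithmetic under `decide +kernel`. [cite: Cox2013, §1.C Lemma 1.14] -/
theorem jacobiSym_prime_eq_ite_nat (p : ℕ) (hp : p.Prime) (hp2 : p ≠ 2) (a : ℕ) :
    J((a : ℤ) | p) = if a % p = 0 then 0 else if (a % p) ^ (p / 2) % p = 1 then 1 else -1 := by
  haveI := Fact.mk hp
  rw [jacobiSym_prime_eq_ite p hp hp2, Int.cast_natCast]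
  have h0 : ((a : ZMod p) = 0) ↔ a % p = 0 := by
    rw [ZMod.natCast_eq_zero_iff, Nat.dvd_iff_mod_eq_zero]
  have h1 : ((a : ZMod p) ^ (p / 2) = 1) ↔ (a % p) ^ (p / 2) % p = 1 := by
    rw [← Nat.pow_mod, ← Nat.cast_pow, show (1 : ZMod p) = ((1 : ℕ) : ZMod p) by rw [Nat.cast_one],
      ZMod.natCast_eq_natCast_iff, Nat.ModEq, Nat.mod_eq_of_lt hp.one_lt]
  simp only [h0, h1]

end Summit.BirchSwinnertonDyer.Rank1Residual.X12.O11.RouteU
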